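import Summits.KontsevichZagierPeriods.KontsevichZagierPeriods.Theorems.LinRedNormalFormArrangementNormalFormStubRebaseSimpleZeroNestedDiffCoreA

/-!
# Stub `stub_rebaseSimpleZeroTwo`, part `rebaseSimpleZero_nestedDifferent` (crux
`ArrangementNormalForm`, line `janus-bands`) — brick `NestedDiffB`

**Type B of the rebase of a nested pair with letters of different `y`-slopes: the lower bound of
the inner fibre is parallel to the inner letter** (`RebaseDiff.good_typeB`, registered as
`rebaseSimpleZero_nestedDiffB`). A clean nest `A(y) < tᵢ < tⱼ < B(y)` with the literal `GS 0 2`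
integrand (simple base pole `r = ℓ₂`, letters `cᵢ, cⱼ` of different `y`-slopes) and `A ∥ cᵢ`,
on whose domain the base pole and the OUTER letter do not vanish and the edge expansion of `tⱼ`
to the slope `λᵢ` about `r` is dominated (`|tⱼ − cⱼ(y)| ≤ C |tⱼ − rot(cⱼ, λᵢ, r)(y)|`;
automatic when `tⱼ − cⱼ` and `(λᵢ − λⱼ)(y − r)` have opposite signs,
`RebaseDiff.good_typeB_of_signs`), is good for `GG 0 2 2`: the reflection `t ↦ −t` of both fibres
(rule 2, `RebasePos.pull` with `μ = −1`) exchanges the roles of the fibres and negates letters and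
bounds, turning the datum into a type-A datum (`RebaseDiff.good_typeA`).

References: M. Kontsevich, D. Zagier, *Periods* (2001), §1.2, rules (1a), (1b), (2).
-/

noncomputable section

open Set MeasureTheory MvPolynomial
open Literature.NumberTheory.Transcendental Literature.ModelTheory.ExponentialFields

namespace Summit.KontsevichZagierPeriods.ArrangementNormalForm.JanusBands

namespace RebaseDiff

open SeparatePos RebasePos RebaseZero RebaseNest

variable {m m' : ℕ} {i j : Fin 2}

/-- The rotated letter of the negated letter to the negated slope is the negated rotated letter
(values). -/
theorem ev_rot_neg (c : Cf) (μ r : ℚ) (y : ℝ) : ev (rot (-c) (-μ) r) y = -ev (rot c μ r) y := by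
  simp only [rot, ev_mk, neg_fst, Prod.snd_neg]
  push_cast
  ring

/-- **Type B: the lower bound of the inner fibre is parallel to the inner letter.** A clean nest
`A(y) < tᵢ < tⱼ < B(y)` with the literal `GS 0 2` integrand (simple base pole `r = ℓ₂`, letters
`cᵢ, cⱼ` of different `y`-slopes) and `A ∥ cᵢ` such that `y ≠ r` and `tⱼ ≠ cⱼ(y)` on the domain
and the edge expansion of `tⱼ` to the slope `λᵢ` about `r` is dominated there,
`|tⱼ − cⱼ(y)| ≤ C |tⱼ − rot(cⱼ, λᵢ, r)(y)|`, is good for `GG 0 2 2`: reflect both fibres and apply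
type A with the roles of the fibres exchanged. [Kontsevich–Zagier 2001, §1.2, rules (1b), (2)] -/
theorem good_typeB (s : KZ.IntegralRep (0 + 1 + 2)) (hij : i ≠ j) (M : Fin m' → Cf) (A Bd : Cf)
    (L : Fin m → (Fin 0 → ℚ) × ℚ) (e : Fin m → ℕ) (p : MvPolynomial (Fin 0) ℚ) (ℓ₁ ℓ₂ : (Fin 0 → ℚ) × ℚ)
    (n₁ n₂ : ℕ) (a : Fin 2 → Option Cf) (ci cj : Cf) (hi : a i = some ci) (hj : a j = some cj)
    (hA : A.1 (Fin.last 0) = ci.1 (Fin.last 0)) (hΔ : ci.1 (Fin.last 0) ≠ cj.1 (Fin.last 0))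
    (h1 : n₁ = 0) (hn : n₂ = 1) (hbd : Bornology.IsBounded s.domain)
    (hdom : s.domain = gDom 0 2 m' M (nlo i A) (nhi j Bd))
    (hint : EqOn s.integrand (glit 0 2 p L e ℓ₁ ℓ₂ n₁ n₂ a) s.domain)
    (hne : ∀ z ∈ s.domain, tv z j ≠ ev cj (yv z)) (hy : ∀ z ∈ s.domain, yv z ≠ ℓ₂.2) (C : ℝ)
    (hC : ∀ z ∈ s.domain, |tv z j - ev cj (yv z)| ≤ C * |tv z j - ev (rot cj (ci.1 (Fin.last 0)) ℓ₂.2) (yv z)|) :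
    Good 2 (KZ.of s) := by
  -- reflection of both fibres
  obtain ⟨s', hkey, hbd', hdom', hint', hrel⟩ := pull (fun _ : Fin 2 => (-1 : ℚ)) (fun _ => 0) (fun _ => 0)
    s M L e p ℓ₁ ℓ₂ n₁ n₂ a (nlo i A) (nhi j Bd) hbd hdom hint (fun _ => by norm_num) (hlink_const (-1) 0 _ _)
  rw [pullLo_reflect hij, pullHi_reflect hij] at hdom'
  have ha : pullA (fun _ : Fin 2 => (-1 : ℚ)) (fun _ => 0) (fun _ => 0) a = fun l => (a l).map Neg.neg := by
    funext l; simp only [pullA, pullC_neg_one]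
  rw [ha] at hint'
  -- transport of the hypotheses through the reflection
  have hid : ∀ (c : Cf) (w : Fin (0 + 1 + 2) → ℝ),
      tv (pullInv (fun _ : Fin 2 => (-1 : ℚ)) (fun _ => 0) (fun _ => 0) w) j - ev c (yv w) =
        -(tv w j - ev (-c) (yv w)) := fun c w => by
    have h := pullInv_fib_sub_affF (fun _ : Fin 2 => (-1 : ℚ)) (fun _ => 0) (fun _ => 0)
      (fun _ => by norm_num) j c w
    rw [affF_eq, affF_eq, pullC_neg_one, Rat.cast_neg, Rat.cast_one, neg_one_mul] at h
    exact h
  have hyv : ∀ w : Fin (0 + 1 + 2) → ℝ,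
      yv (pullInv (fun _ : Fin 2 => (-1 : ℚ)) (fun _ => 0) (fun _ => 0) w) = yv w := fun w =>
    pullInv_base _ _ _ w (Fin.last 0)
  refine RebaseZero.good_of_sub_mem hrel (good_typeA s' hij.symm M (-Bd) (-A) L e
    (MvPolynomial.C (pullQ (fun _ : Fin 2 => (-1 : ℚ)) a) * p) ℓ₁ ℓ₂ n₁ n₂ _ (-cj) (-ci)
    (by simp only [hj, Option.map_some]) (by simp only [hi, Option.map_some])
    (by rw [neg_fst, neg_fst, hA]) (fun h => hΔ ?_) h1 hn hbd' hdom' hint'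
    (fun w hw => ?_) (fun w hw => ?_) C (fun w hw => ?_))
  · rw [neg_fst, neg_fst] at h
    exact (neg_injective h).symm
  · have h := sub_ne_zero.2 (hne _ ((hkey w).1 hw))
    rw [hyv, hid] at h
    intro h'
    exact h (by rw [h', sub_self, neg_zero])
  · have h := hy _ ((hkey w).1 hw)
    rwa [hyv] at h
  · have h := hC _ ((hkey w).1 hw)
    rw [hyv, hid, hid, abs_neg, abs_neg, ev_neg (rot cj (ci.1 (Fin.last 0)) ℓ₂.2)] at h
    rw [neg_fst, ev_rot_neg]
    exact h

/-- **Type B with automatic domination by signs**: `tⱼ − cⱼ(y)` of constant weak sign `ε`,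
`(λᵢ − λⱼ)(y − r)` of weak sign `−ε` on the domain. -/
theorem good_typeB_of_signs (s : KZ.IntegralRep (0 + 1 + 2)) (hij : i ≠ j) (M : Fin m' → Cf) (A Bd : Cf)
    (L : Fin m → (Fin 0 → ℚ) × ℚ) (e : Fin m → ℕ) (p : MvPolynomial (Fin 0) ℚ) (ℓ₁ ℓ₂ : (Fin 0 → ℚ) × ℚ)
    (n₁ n₂ : ℕ) (a : Fin 2 → Option Cf) (ci cj : Cf) (hi : a i = some ci) (hj : a j = some cj)
    (hA : A.1 (Fin.last 0) = ci.1 (Fin.last 0)) (hΔ : ci.1 (Fin.last 0) ≠ cj.1 (Fin.last 0))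
    (h1 : n₁ = 0) (hn : n₂ = 1) (hbd : Bornology.IsBounded s.domain)
    (hdom : s.domain = gDom 0 2 m' M (nlo i A) (nhi j Bd))
    (hint : EqOn s.integrand (glit 0 2 p L e ℓ₁ ℓ₂ n₁ n₂ a) s.domain)
    (hne : ∀ z ∈ s.domain, tv z j ≠ ev cj (yv z)) (hy : ∀ z ∈ s.domain, yv z ≠ ℓ₂.2) (ε : ℝ)
    (hε : ε = 1 ∨ ε = -1) (hP : ∀ z ∈ s.domain, 0 ≤ ε * (tv z j - ev cj (yv z)))
    (hQ : ∀ z ∈ s.domain, ε * ((((ci.1 (Fin.last 0) - cj.1 (Fin.last 0) : ℚ) : ℝ)) * (yv z - ℓ₂.2)) ≤ 0) :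
    Good 2 (KZ.of s) :=
  good_typeB s hij M A Bd L e p ℓ₁ ℓ₂ n₁ n₂ a ci cj hi hj hA hΔ h1 hn hbd hdom hint hne hy 1 fun z hz =>
    dominated_of_signs j cj (ci.1 (Fin.last 0)) ℓ₂.2 ε hε z (hP z hz) (hQ z hz)

end RebaseDiff

/-- **Registered part `rebaseSimpleZero_nestedDiffB` of `rebaseSimpleZero_nestedDifferent` (stub
`stub_rebaseSimpleZeroTwo`, line `janus-bands`): type B of the rebase of a nested pair with letters
of DIFFERENT `y`-slopes.** A clean nest `A(y) < tᵢ < tⱼ < B(y)` (literal `GS 0 2` datum, simple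
base pole `r = ℓ₂.2`, both fibres lettered, `λᵢ ≠ λⱼ`) whose inner lower bound is parallel to the
inner letter (`A ∥ cᵢ`), on whose domain the base pole and the outer letter do not vanish and the
edge expansion of `tⱼ` to the slope `λᵢ` about `r` is dominated
(`|tⱼ − cⱼ(y)| ≤ C |tⱼ − rot(cⱼ, λᵢ, r)(y)|`), is congruent modulo `KZ.relations` to the
subgroup generated by the literal rebased class `GG 0 2 2` (`RebaseDiff.good_typeB`: reflection
of both fibres, then type A). [Kontsevich–Zagier 2001, §1.2] -/
theorem rebaseSimpleZero_nestedDiffB (m m' n₁ n₂ : ℕ) (s : KZ.IntegralRep (0 + 1 + 2)) (M : Fin m' → (Fin (0 + 1) → ℚ) × ℚ) (L : Fin m → (Fin 0 → ℚ) × ℚ) (e : Fin m → ℕ) (p : MvPolynomial (Fin 0) ℚ) (ℓ₁ ℓ₂ : (Fin 0 → ℚ) × ℚ) (a : Fin 2 → Option ((Fin (0 + 1) → ℚ) × ℚ)) (i j : Fin 2) (hij : i ≠ j) (A Bd ci cj : (Fin (0 + 1) → ℚ) × ℚ) (hi : a i = some ci) (hj : a j = some cj) (hA : A.1 (Fin.last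 0) = ci.1 (Fin.last 0)) (hΔ : ci.1 (Fin.last 0) ≠ cj.1 (Fin.last 0)) (h1 : n₁ = 0) (hn : n₂ = 1) (hbd : Bornology.IsBounded s.domain) (hdom : s.domain = SeparatePos.gDom 0 2 m' M (RebaseNest.nlo i A) (RebaseNest.nhi j Bd)) (hint : EqOn s.integrand (RebasePos.glit 0 2 p L e ℓ₁ ℓ₂ n₁ n₂ a) s.domain) (hne : ∀ z ∈ s.domain, RebaseZero.tv z j ≠ RebaseZero.ev cj (RebaseZero.yv z)) (hy : ∀ z ∈ s.domain, RebaseZero.yv z ≠ ℓ₂.2) (C : ℝ) (hC : ∀ z ∈ s.domain, |RebaseZero.tv z j - RebaseZero.ev cj (RebaseZero.yv z)| ≤ C * |RebaseZero.tv z j - RebaseZero.ev (RebaseDiff.rot cj (ci.1 (Fin.last 0)) ℓ₂.2) (RebaseZero.yv z)|) : ∃ c ∈ AddSubgroup.closure (SeparatePos.GGset 0 2 2), KZ.of s - c ∈ KZ.relations :=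
  RebaseDiff.good_typeB s hij M A Bd L e p ℓ₁ ℓ₂ n₁ n₂ a ci cj hi hj hA hΔ h1 hn hbd hdom hint hne hy C hC

end Summit.KontsevichZagierPeriods.ArrangementNormalForm.JanusBands
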